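import Mathlib

/-!
# T5VolumePositive — the measure of a volume form is positive on open sets and finite on compacts

Kernel support (blind lane, Mathlib only) for route/T5-N1-hodge-p6.md, the sentence of §H2.2 / §H9
listed as prose at v6.1: «the positivity of `Vol_S` on open sets (a volume form is nowhere zero)».
The model is the chart level of Voisin, Hodge Theory and Complex Algebraic Geometry I, p. 63
(Lemma 3.8 and the lines before it): in a chart the volume form of a hermitian metric reads
`ρ(x) dx₁ ∧ ⋯ ∧ dx₄` with a continuous, nowhere-vanishing density `ρ`, and the measure it defines is
`μ.withDensity (ENNReal.ofReal ∘ ρ)` for `μ` the Lebesgue (add-Haar) measure of the chart.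

What is proved here:
* `withDensity_apply_eq_zero_iff_of_ne_zero` — for a density that vanishes nowhere, a set is null
  for `μ.withDensity f` iff it is null for `μ`;
* `isOpenPosMeasure_withDensity` — such a density preserves positivity on non-empty open sets;
* `isOpenPosMeasure_withDensity_ofReal` / `_abs` — the real-density forms (continuous `ρ > 0`,
  resp. continuous `ρ ≠ 0` with the density `|ρ|`);
* `isFiniteMeasureOnCompacts_withDensity_ofReal` — a continuous real density keeps the measure finite
  on compact sets (Mathlib's `IsLocallyFiniteMeasure.withDensity_ofReal` + local compactness);
* `chartVolume_isOpenPosMeasure` / `chartVolume_isFiniteMeasureOnCompacts` — the two hypotheses of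
  `T5L2Positivity` (a measure positive on non-empty open sets and finite on compacts) hold for the
  chart measure of a volume form against any add-Haar measure of a finite-dimensional real space;
* `sign_const_of_ne_zero` — on a connected chart a continuous nowhere-zero density has a constant
  sign (intermediate value theorem), so «positively oriented» (Voisin p. 63 l. 23) is a condition on
  the chart, not on the point.

Nothing geometric is constructed: the manifold, the bundle `Λ⁴T^*S` and the passage from a form to a
measure stay prose (the chart-to-manifold bookkeeping of the memo).
-/

namespace Summit.Ventures.HodgeRepro2.T5VolumePositive

open MeasureTheory Measure Set

section Null

variable {X : Type*} {m : MeasurableSpace X} {μ : Measure X}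

/-- For a density `f` that vanishes nowhere, a set is null for `μ.withDensity f` iff it is null for
`μ` (`withDensity_apply_eq_zero'` with `{x | f x ≠ 0} = univ`). -/
theorem withDensity_apply_eq_zero_iff_of_ne_zero {f : X → ENNReal} (hf : AEMeasurable f μ)
    (hf0 : ∀ x, f x ≠ 0) (s : Set X) : μ.withDensity f s = 0 ↔ μ s = 0 := by
  rw [withDensity_apply_eq_zero' hf]
  have h : {x | f x ≠ 0} = univ := eq_univ_of_forall hf0
  rw [h, univ_inter]

end Null

section General

variable {X : Type*} [TopologicalSpace X] {m : MeasurableSpace X} {μ : Measure X}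

/-- A nowhere-vanishing (a.e.-measurable) density preserves positivity on non-empty open sets. -/
theorem isOpenPosMeasure_withDensity [IsOpenPosMeasure μ] {f : X → ENNReal}
    (hf : AEMeasurable f μ) (hf0 : ∀ x, f x ≠ 0) : IsOpenPosMeasure (μ.withDensity f) :=
  ⟨fun U hU hne h0 =>
    hU.measure_ne_zero μ hne ((withDensity_apply_eq_zero_iff_of_ne_zero hf hf0 U).1 h0)⟩

/-- Real form: a continuous, everywhere positive density `ρ` gives an open-positive measure
`μ.withDensity (ENNReal.ofReal ∘ ρ)`. -/
theorem isOpenPosMeasure_withDensity_ofReal [OpensMeasurableSpace X] [IsOpenPosMeasure μ]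
    {ρ : X → ℝ} (hρ : Continuous ρ) (hpos : ∀ x, 0 < ρ x) :
    IsOpenPosMeasure (μ.withDensity fun x => ENNReal.ofReal (ρ x)) :=
  isOpenPosMeasure_withDensity hρ.measurable.ennreal_ofReal.aemeasurable
    (fun x => ENNReal.ofReal_ne_zero_iff.2 (hpos x))

/-- Real form with a sign: a continuous, nowhere-zero density `ρ` (the coefficient of a volume
form in an arbitrary, not necessarily oriented, chart) gives an open-positive measure with the
density `|ρ|`. -/
theorem isOpenPosMeasure_withDensity_ofReal_abs [OpensMeasurableSpace X] [IsOpenPosMeasure μ]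
    {ρ : X → ℝ} (hρ : Continuous ρ) (hne : ∀ x, ρ x ≠ 0) :
    IsOpenPosMeasure (μ.withDensity fun x => ENNReal.ofReal |ρ x|) :=
  isOpenPosMeasure_withDensity_ofReal (continuous_abs.comp hρ) (fun x => abs_pos.2 (hne x))

/-- A continuous real density keeps a measure that is finite on compacts finite on compacts, on a
(weakly) locally compact space: Mathlib's `IsLocallyFiniteMeasure.withDensity_ofReal` composed with
the two instances `IsFiniteMeasureOnCompacts ↔ IsLocallyFiniteMeasure`. -/
theorem isFiniteMeasureOnCompacts_withDensity_ofReal [OpensMeasurableSpace X]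
    [WeaklyLocallyCompactSpace X] [IsFiniteMeasureOnCompacts μ] {ρ : X → ℝ} (hρ : Continuous ρ) :
    IsFiniteMeasureOnCompacts (μ.withDensity fun x => ENNReal.ofReal (ρ x)) :=
  haveI : IsLocallyFiniteMeasure (μ.withDensity fun x => ENNReal.ofReal (ρ x)) :=
    IsLocallyFiniteMeasure.withDensity_ofReal hρ
  inferInstance

/-- Finiteness on compacts with the density `|ρ|`. -/
theorem isFiniteMeasureOnCompacts_withDensity_ofReal_abs [OpensMeasurableSpace X]
    [WeaklyLocallyCompactSpace X] [IsFiniteMeasureOnCompacts μ] {ρ : X → ℝ} (hρ : Continuous ρ) :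
    IsFiniteMeasureOnCompacts (μ.withDensity fun x => ENNReal.ofReal |ρ x|) :=
  isFiniteMeasureOnCompacts_withDensity_ofReal (continuous_abs.comp hρ)

end General

section Chart

variable {E : Type*} [NormedAddCommGroup E] [NormedSpace ℝ E] [FiniteDimensional ℝ E]
  [MeasurableSpace E] [BorelSpace E] (μ : Measure E) [μ.IsAddHaarMeasure]

omit [NormedSpace ℝ E] [FiniteDimensional ℝ E] in
/-- The chart measure of a volume form (continuous coefficient `ρ ≠ 0` against an add-Haar measure
of the chart) is positive on non-empty open sets: the first hypothesis of `T5L2Positivity`. -/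
theorem chartVolume_isOpenPosMeasure {ρ : E → ℝ} (hρ : Continuous ρ) (hne : ∀ x, ρ x ≠ 0) :
    IsOpenPosMeasure (μ.withDensity fun x => ENNReal.ofReal |ρ x|) :=
  isOpenPosMeasure_withDensity_ofReal_abs hρ hne

/-- The chart measure of a volume form is finite on compact sets: the second hypothesis of
`T5L2Positivity` (a finite-dimensional real normed space is a proper, hence locally compact, space).
-/
theorem chartVolume_isFiniteMeasureOnCompacts {ρ : E → ℝ} (hρ : Continuous ρ) :
    IsFiniteMeasureOnCompacts (μ.withDensity fun x => ENNReal.ofReal |ρ x|) :=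
  isFiniteMeasureOnCompacts_withDensity_ofReal_abs hρ

end Chart

section Sign

variable {E : Type*} [TopologicalSpace E]

/-- On a connected chart a continuous, nowhere-zero density has a constant sign: either positive
everywhere or negative everywhere (intermediate value theorem). This is why «positively oriented»
is a property of the chart. -/
theorem sign_const_of_ne_zero {U : Set E} (hU : IsPreconnected U) {ρ : E → ℝ}
    (hρ : ContinuousOn ρ U) (hne : ∀ x ∈ U, ρ x ≠ 0) :
    (∀ x ∈ U, 0 < ρ x) ∨ (∀ x ∈ U, ρ x < 0) := by
  by_contra hcon
  rw [not_or] at hcon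
  obtain ⟨h1, h2⟩ := hcon
  simp only [not_forall, not_lt, exists_prop] at h1 h2
  obtain ⟨x, hxU, hx⟩ := h1
  obtain ⟨y, hyU, hy⟩ := h2
  have hx' : ρ x < 0 := lt_of_le_of_ne hx (hne x hxU)
  have hy' : 0 < ρ y := lt_of_le_of_ne hy (Ne.symm (hne y hyU))
  have h0 : (0 : ℝ) ∈ Icc (ρ x) (ρ y) := ⟨hx'.le, hy'.le⟩
  obtain ⟨z, hzU, hz⟩ := hU.intermediate_value hxU hyU hρ h0
  exact hne z hzU hz

/-- In an oriented chart (density positive at one point of a connected chart) the density is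
positive everywhere, and the measure of the volume form is `μ.withDensity (ENNReal.ofReal ∘ ρ)`
with no absolute value. -/
theorem pos_of_pos_of_ne_zero {U : Set E} (hU : IsPreconnected U) {ρ : E → ℝ}
    (hρ : ContinuousOn ρ U) (hne : ∀ x ∈ U, ρ x ≠ 0) {x₀ : E} (hx₀ : x₀ ∈ U) (hpos : 0 < ρ x₀) :
    ∀ x ∈ U, 0 < ρ x := by
  rcases sign_const_of_ne_zero hU hρ hne with h | h
  · exact h
  · exact absurd hpos (not_lt.2 (h x₀ hx₀).le)

end Sign

end Summit.Ventures.HodgeRepro2.T5VolumePositive
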